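import Mathlib

/-!
# Klainerman–Szeftel Lemma 9.4.13 / §9.4.8: the exponent count behind "the weights in `r`, `u` and `u̲` are enough to take care of the spacetime integrations" — a table of margins, with the supercritical case certified

CITATION HEADER (lean-in-tree rule 2026-08-18).  This module records ARITHMETIC OF EXPONENTS read off

* S. Klainerman, J. Szeftel, *Kerr stability for small angular momentum*, arXiv:2104.11857 (v1, 2021; TeX source
  `Main-Kerr-arxiv.tex`, line numbers `KS l.N`) = bib key `KlainermanSzeftel2021`; journal record Pure Appl. Math. Q.
  **19** (2023) no. 3 = bib key `KlainermanSzeftel2023`.  RATES ARE v1 RATES (stamp 2026-08-18, audit finding K20b-J): the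
  refereed text, read in the authors' accepted manuscript HAL hal-04280491, keeps Definition 9.2.4 of `(Γ_g, Γ_b)` and the
  norms (9.4.1)–(9.4.7) verbatim but prints a DIFFERENT sup display in Lemma 9.4.13 ((9.4.24) = (9.4.32) there, PDF pages
  624 and 626 of that file): `Γ_g'` weight `(r u^{½+δ_dec} + u^{1+3δ_dec/4})` on `ᵉˣᵗ𝓜 ∪ 𝓜top'(r ≥ r₀)` in place of v1's `r²u^{½+δ_dec}`
  (l.24413–24419), `Γ_b'` weight `r u^{1+3δ_dec/4}` in place of `r u^{1+δ_dec}`, while the PG input of Theorem M7 keeps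
  `r²u^{½+δ_dec}` ((9.4.25) there = v1 l.24364–24369).  The recorded rates `rateABP_recorded = 3`, `rateBb_recorded = 2`,
  `rateAb_recorded = 1` of §1 below are therefore the v1 rates; the same count with the `Γ_g'` sup `r`-exponent as a
  parameter (v1: 2, refereed as printed: 1) is the companion module `…RefereedRateCount`: under the refereed display read
  literally the margins of the `Γ_g'` rows below (`A`, `B`, `P̌`, recorded rate 3 ↦ 2) DROP BY 2 (`RefereedRateCount.J_shift`),
  the `Γ_b'` rows (`B̲`, `A̲`) are unchanged.

THE PRINTED STEP.  Lemma 9.4.13 (`lemma:proofofeq:initializationofiterationassumptioninproofThmM8`, KS l.24350–24360):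
`𝔖_{k_small−1} + ℜ_{k_small−1} ≲ ε₀`, initialising the iteration of §9.4.4 (Theorem M8).  Its proof (KS l.24362–24427)
transfers the SUP decay of Theorem M7 — display l.24364–24369: `sup_{ᵉˣᵗ𝓜} { r²u^{½+δ_dec}|𝔡^{≤k}Γ_g| + ru^{1+δ_dec}|𝔡^{≤k}Γ_b| }
≲ ε₀`, `k ≤ k_small`, with `Γ_g ∋ rP̌, rB, rA`, `Γ_b ∋ rB̲, A̲` (Definition l.4210–4232 / PT case l.23388–23410) — to the PT
frames (items 1–5) and concludes (l.24420–24425): "The weights in `r`, `u` and `u̲` are enough to take care of the spacetime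
integrations in the global norms defined in section 9.4.1 … and we finally obtain `𝔖_{k_small−1} + ℜ_{k_small−1} ≲ ε₀`."
The global norms (KS §9.4.1): `ℜ*_k² = ∫_{Σ_*} r^{4+δ_B}(|𝔡^{≤k}A|² + |𝔡^{≤k}B|²) + r⁴|𝔡^{≤k}P̌|² + r²|𝔡^{≤k}B̲|² + |𝔡^{≤k}A̲|²`
(l.23886–23889), `ᵉˣᵗℜ_k² = ∫_{ᵉˣᵗ𝓜} r^{3+δ_B}|𝔡^{≤k}(A,B)|² + r^{3−δ_B}(|𝔡^{≤k}P̌|² + r^{−2}|𝔡^{≤k}B̲|² + r^{−4}|𝔡^{≤k}A̲|²)`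
(l.23912–23915), and the slice functional of §9.4.8, `L_*²(k) = ∫_{u=u_*'} |Ř|²_{w,k} + ∫_{Σ_*∩{u=u_*'}} |Γ̌|²_{w,k}` with
`|Ř|²_{w,k} = r^{3+δ_B}|𝔡_*^{≤k}(A,B)|² + r^{3−δ_B}|𝔡_*^{≤k}P̌|² + r^{1−δ_B}|𝔡_*^{≤k}B̲|²` ((9.4.34)–(9.4.35), l.24452–24461), whose
low-level instance "in view of (9.4.22), `L_*(k_small−1) ≲ ε₀`" (l.24684–24687) is the registry node KS9.4.8-L0 of the audit.
Constants: `δ_B > 2δ_dec` ((3.4.4), l.6076–6080); `r_* = δ_* ε₀^{-1} u_*^{1+δ_dec}` (`eq:behaviorofronS-star`, l.6103–6106) and `r ≤ r_*(1+O(ε₀))`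
on `𝓜` (l.10137–10158), so radial integrals on `ᵉˣᵗ𝓜` and on the cones `{u = u₁}` run up to `R ≍ r_*`.

THE COUNT (this module).  For a component `ψ` with pointwise bound `|𝔡^{≤k}ψ| ≲ ε₀ r^{-a} u^{-b}` and a weight `r^w`, the
integrand of the cone flux / of the bulk at fixed `u` is `r^{w} · r^{-2a} · r²` (the audit cell's READING of the measures:
area element comparable to `r² dr dσ` on `{u = u₁} ∩ ᵉˣᵗ𝓜` and volume comparable to `r² dr du dσ` on `ᵉˣᵗ𝓜` in the outgoing
PG coordinates `(u, r, θ, φ)` — consistent with KS's own weights being one power of `r` apart on `Σ_*` (`r^{4+δ_B}`) and in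
the bulk (`r^{3+δ_B}`)), i.e. `r^{w+2−2a}`; it is integrable on `[r₀, ∞)` —
equivalently `∫_{r₀}^{R}` is bounded UNIFORMLY in `R` — iff `w + 2 − 2a < −1`, i.e. iff the MARGIN `2a − (w+3)` is positive
(`margin`, `radial_bounded_of_margin_pos`, `radial_unbounded_of_margin_nonpos`).  The table `§2` evaluates the margin per
component against the RECORDED rates (`a = 3` for `A, B, P̌` from `r²·|rψ|`, `a = 2` for `B̲`, `a = 1` for `A̲` from `r·|Γ_b|`):
`P̌: +δ_B`, `B̲: +δ_B`, `A̲: +δ_B` (fine), but `(A, B): −δ_B` — SUPERCRITICAL: with the recorded rate the `r^{3+δ_B}` terms are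
NOT taken care of by the weights (`∫_{r₀}^{R} r^{-1+δ_B} dr = (R^{δ_B} − r₀^{δ_B})/δ_B → ∞`, `coneFluxAB_recorded_unbounded`; at
`R ≍ r_*` this is a factor `≍ (δ_* ε₀^{-1} u_*^{1+δ_dec})^{δ_B}/δ_B`).  What closes the count in print elsewhere in KS (§3):
for `A`, Theorem M1 item 2 (l.6684–6687): `r³(2r+u)^{½+δ_extra}|𝔡^k A| ≲ ε₀`, `k ≤ k_small+100`, i.e. rate `7/2 + δ_extra` in `r` on
`{r ≥ u}` — margin `1 + 2δ_extra − δ_B > 0`; for `B`, Proposition `Proposition:estimatesforBPcXhZc-halfdecayinu` INSIDE the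
proof of Theorem M4 (KS l.16631–16637): `|𝔡^{≤k_*−6}B| ≲ ε₀ r^{-3−δ'} u^{-½−δ_dec}` with `δ' = ½(δ_extra − δ_dec)` (l.13770),
`k_* = k_small + 60` (l.13511–13513) — margin `2δ' − δ_B = δ_extra − δ_dec − δ_B`, positive iff `δ_B < δ_extra − δ_dec`
(`marginB_improved_pos_iff`).  KS (3.4.4) lists `δ_B > 2δ_dec` and quotes `δ_extra` from Theorem M1 only as "there exists
`δ_extra > δ_dec`" (l.6672), so within KS alone the sign is undecided (`marginB_undecided`: parameter points either way).  BUT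
Theorem M1 is proved in the companion paper, and there `δ_extra` has a printed VALUE: GKS (arXiv:2205.14808, Theorem M1, ch. 11
Step 7, TeX l.22524; refereed Pure Appl. Math. Q. **20** (2024) no. 7, 2865–3849 = bib key `GiorgiKlainermanSzeftel2024`, read in
the authors' version HAL hal-05348127, whose p. 532 (PDF p. 533) — a page of that text, not a journal page; REFEREE #19 L-6 — prints
verbatim "Hence, choosing `δ_extra = (3δ_dec − 2δ)/2 > δ_dec`") — more generally `(3δ_h − 2δ)/2` with `δ_h ≤ δ_dec` the decay rate fed into GKS (11.1.1) (`= InterpolatedRates.deltaExtra`,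
whose variants `δ_h = δ_dec − 2δ₀`, `(3/4)δ_dec` are all `≤ δ_dec`).  With that value the `B`-margin is `(3δ_h − 2δ)/2 − δ_dec − δ_B
≤ δ_dec/2 − δ − δ_B`, which under (3.4.4) `δ_B > 2δ_dec` is `< −(3/2)δ_dec − δ < 0` (`marginB_GKS`, `marginB_GKS_neg`): none of
the `ε₀`-size pointwise bounds for `B` on the exterior region that we located in KS — Thm M7's `𝔑^{(Dec)}` (rate 3, l.5826–5831),
this Proposition (rate `3+δ'`), Thm M0 (rate `7/2+δ_B` but on the initial hypersurface `𝓑₁` only, l.6653–6657), the `Σ_*`-bounds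
(rate `7/2+δ_extra` on `Σ_*` only, Proposition l.12782–12793), the regional norms `𝔇'_{k,ℛ}` (rate `7/2+δ_dec'` but at bootstrap size `ε`,
l.8483–8501) — yields AT `ε₀`-SIZE the bound that (9.4.22) asserts for the `r^{3+δ_B}`-weighted `B`-terms of `L_*²(k_small−1)` /
`ᵉˣᵗℜ²_{k_small−1}` (a spacetime integral over the exterior region, l.23912–23915, volume `≍ r² dr du`): each is radially
supercritical, its contribution growing with the outer radius `≍ r_*`.  SIZE `ε` OF THESE NORMS IS OUTRIGHT — the bootstrap
assumption BA-PT = (9.4.20), l.24317–24319, is `𝔖_k + ℜ_k ≤ ε` for `k ≤ k_large + 7` (audit-cell referee note V8, REFEREE.md #18;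
lead block 9 (0)): every "unbounded / not uniform in `R ≍ r_*`" statement of this module is about what a given `ε₀`-size
POINTWISE input yields for the IMPROVEMENT `ε → ε₀` that (9.4.22) claims — consumed as the iteration base (Remark 9.4.14,
l.24467–24473) and in `L_*(k_small−1) ≲ ε₀` (l.24684–24687) — never about the paper's norms, which are `≤ ε` by assumption.  Mixing the
`ε₀`-size input with the size-`ε` pointwise bound of BA-B (`ᵉˣᵗ𝔅_k`, l.5811–5815, rate `7/2 + δ_B/2`, margin exactly `1`) gives the
intermediate scale `ε₀^{1−κ}`, `κ ∈ (0, 1/3)`, uniformly in the bootstrap time exactly in the window `2δ_dec < δ_B < δ_dec + δ_extra` —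
module `…KlainermanSzeftel2021.MixedRateCount` (repair variant V-BA).  The `A`-terms close from
Thm M1 in the window `2δ_dec < δ_B < 2δ_extra` (far field `marginA_M1`; near field `r ≤ u` by the `u`-count).  (What would close the
`B`-count: any rate `a_B > 3 + δ_B/2` at `ε₀`-size and level `≤ k_small − 1` on the
extended spacetime — e.g. `a_B = 7/2 + δ_extra`, the rate of Theorem M1's `A` and of KS's own `Σ_*`-bound `sup_{Σ_*} r^{7/2+δ_extra}
|𝔡^k B'| ≲ ε₀` (l.12791), margin `1 + 2δ_extra − δ_B` (`marginB_rateM1`, = `marginA_M1`), which an outward integration of the Bianchi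
transport equation for `r⁴B` sourced by `𝔡A` at Theorem M1's rate would plausibly give in the far field (`r⁴·r^{-9/2-δ_extra}` integrates
to `r^{1/2-δ_extra}`; the peeling rate `4`, margin `2 − δ_B` `marginB_rate4`, would need more); this is the audit cell's suggestion of a
repair route, NOT a statement found in KS or GKS for the exterior region (KS obtains `B` there through `𝒟⊗̂B + (Z+4H)⊗̂B = ∇₃A + …`,
Step 2 of the proof of Proposition `Proposition:estimatesforBPcXhZc-halfdecayinu` l.16632–16640, l.16656–16668, display l.16659 — locator corrected after REFEREE #20 L-7; l.16645–16654 is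
Step 1, the `∇₄X̂` transport — which yields `3 + δ'`) — or an integrated (flux / `r^p`) estimate for `B` at low level.)  The `u`-integration of the bulk then converges from the `u^{-½-δ_dec}`
factor (`2b = 1 + 2δ_dec > 1`); for `A`, whose M1 rate is in `(2r+u)`-form, splitting `(2r+u)^{-(½+δ_extra)} ≤
(2r)^{-θ(½+δ_extra)} u^{-(1-θ)(½+δ_extra)}` needs `δ_B/(1+2δ_extra) < θ < 2δ_extra/(1+2δ_extra)`, i.e. `δ_B < 2δ_extra`, implied by
the `B`-constraint.
On `Σ_*` (`r ≍ r_*`, area `≍ r_*² du`) the `r^{4+δ_B}|B|²` term carries the power `r_*^{6+δ_B−2a}`: `+δ_B` at the recorded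
rate, `−1` at the boundedness rate `7/2 + δ_B/2` of `ᵉˣᵗ𝔅_k` (l.5813) — `starPowerB_recorded`, `starPowerB_bounded`.

STATUS.  This is a CENSUS OBSERVATION of the audit cell `pub-kerr` (its GAPS.md item K20b), typed as arithmetic: it does
not assert that Lemma 9.4.13 is false — the improved profiles for `A` and `B` exist in KS (M1; Prop. l.16631) — it records
that the sentence l.24420–24425 does not verify from the decay NORM `𝔑^{(Dec)}_{k_small}` that Theorem M7 (l.6791–6800)
transports to the extended spacetime, nor — for the `B`-terms, AT SIZE `ε₀` — from any pointwise bound printed in KS/GKS once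
GKS's value of `δ_extra` is inserted (v2 of this module, same day: `marginB_GKS_neg`), and names what the `ε₀`-count needs instead
(a pointwise `r`-rate `> 3 + δ_B/2` for `𝔡^{≤k_small−1}B` at `ε₀`-size on the extended spacetime, or an integrated estimate); the
size-`ε` statement `ℜ_{k_small−1} ≤ ε` is the bootstrap assumption (9.4.20) itself and is not in question (v4: referee V8).  PRECISE
GAP (class E, priced), no error claimed.  KS is a refereed publication, under adjudication in the audit cell: its displays enter here
as parameters, never as cited facts; nothing here is Final-State-Conjecture progress.  Mathlib only; complementary to
`…KlainermanSzeftel2021.SliceChoice` (whose hypothesis `hdec` is the `ε₀`-size weighted sup-decay this count starts from), to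
`…GiorgiKlainermanSzeftel2022.FluxWeightPlacement` (weights placed on the `u`-side) and to `…KlainermanSzeftel2021.MixedRateCount`
(which imports this module); imports none of them.
-/

open Real Set MeasureTheory intervalIntegral Filter

noncomputable section

namespace Literature.Geometry.Lorentzian.KlainermanSzeftel2021.SupToFluxExponents

/-! ## §1 Weights, rates, margin -/

/-- Weight exponent of `(A, B)` in `|Ř|²_{w,k}` (9.4.35) and in `ᵉˣᵗℜ_k²` (l.23912–23916): `r^{3+δ_B}`.
[cite: KlainermanSzeftel2021, (9.4.35), TeX l.24456–24461] -/
def wAB (δB : ℝ) : ℝ := 3 + δB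

/-- Weight exponent of `P̌`: `r^{3−δ_B}`.  [cite: KlainermanSzeftel2021, (9.4.35), TeX l.24456–24461] -/
def wP (δB : ℝ) : ℝ := 3 - δB

/-- Weight exponent of `B̲` in `|Ř|²_{w,k}`: `r^{1−δ_B}` (in `ᵉˣᵗℜ_k²`: `r^{3−δ_B}·r^{−2}`, the same).
[cite: KlainermanSzeftel2021, (9.4.35), TeX l.24456–24461] -/
def wBb (δB : ℝ) : ℝ := 1 - δB

/-- Weight exponent of `A̲` in `ᵉˣᵗℜ_k²`: `r^{3−δ_B}·r^{−4} = r^{−1−δ_B}`.  [cite: KlainermanSzeftel2021, §9.4.1 ext curvature norm, TeX l.23912–23915] -/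
def wAb (δB : ℝ) : ℝ := -1 - δB

/-- Weight exponent of `(A, B)` in `ℜ*_k²` on `Σ_*`: `r^{4+δ_B}`.  [cite: KlainermanSzeftel2021, §9.4.1 curvature norm on Sigma_*, TeX l.23886–23889] -/
def wABstar (δB : ℝ) : ℝ := 4 + δB

/-- RECORDED pointwise `r`-rate of `A`, `B`, `P̌` at `ε₀`-size, `k ≤ k_small`: `3`, from `r²u^{½+δ_dec}|𝔡^{≤k}Γ_g| ≲ ε₀` with
`rA, rB, rP̌ ∈ Γ_g` (KS l.24364–24369 with Definition l.4210–4232).  [cite: KlainermanSzeftel2021, proof of Lemma 9.4.13, TeX l.24364–24369] -/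
def rateABP_recorded : ℝ := 3

/-- RECORDED rate of `B̲`: `2` (`rB̲ ∈ Γ_b`, weight `r`).  [cite: KlainermanSzeftel2021, proof of Lemma 9.4.13, TeX l.24364–24369] -/
def rateBb_recorded : ℝ := 2

/-- RECORDED rate of `A̲`: `1` (`A̲ ∈ Γ_b`, weight `r`).  [cite: KlainermanSzeftel2021, proof of Lemma 9.4.13, TeX l.24364–24369] -/
def rateAb_recorded : ℝ := 1

/-- Theorem M1's rate for `A` on `{r ≥ u}`: `r³(2r+u)^{½+δ_extra}|𝔡^k A| ≲ ε₀` gives `r^{-(7/2+δ_extra)}` there.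
[cite: KlainermanSzeftel2021, Theorem M1 item 2, TeX l.6684–6687] -/
def rateA_M1 (δextra : ℝ) : ℝ := 7 / 2 + δextra

/-- KS's `δ' = ½(δ_extra − δ_dec)`.  [cite: KlainermanSzeftel2021, TeX l.13770] -/
def deltaPrime (δextra δdec : ℝ) : ℝ := (δextra - δdec) / 2

/-- The improved rate for `B` proved inside Theorem M4: `|𝔡^{≤k_*−6}B| ≲ ε₀ r^{-3−δ'} u^{-½−δ_dec}`.
[cite: KlainermanSzeftel2021, Proposition (estimates for B, P, Xhat, Z with u^{-1/2-delta} decay), TeX l.16631–16637] -/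
def rateB_improved (δextra δdec : ℝ) : ℝ := 3 + deltaPrime δextra δdec

/-- The boundedness rate of `(A, B)` in `ᵉˣᵗ𝔅_k`: `r^{7/2+δ_B/2}(|𝔡^{≤k}A| + |𝔡^{≤k}B|)` (size `ε` under BA-B).
[cite: KlainermanSzeftel2021, boundedness norms in Mext, TeX l.5813] -/
def rateAB_bounded (δB : ℝ) : ℝ := 7 / 2 + δB / 2

/-- MARGIN of a weight-`r^w` cone-flux / fixed-`u` bulk term against a pointwise rate `r^{-a}`: the integrand is `r^{w+2−2a}`
(area `≍ r² dr`), integrable at infinity iff `w + 2 − 2a < −1` iff `0 < 2a − (w+3)`.  [folklore] -/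
def margin (w a : ℝ) : ℝ := 2 * a - (w + 3)

/-- The integrand exponent in terms of the margin.  [folklore] -/
theorem exponent_eq (w a : ℝ) : w + 2 - 2 * a = -1 - margin w a := by unfold margin; ring

/-! ## §2 The table of margins -/

/-- `(A, B)` at the RECORDED rate: margin `−δ_B` — negative for `δ_B > 0`.
[cite: KlainermanSzeftel2021, (9.4.35) vs proof of Lemma 9.4.13, TeX l.24456–24461, l.24364–24369] -/
theorem marginAB_recorded (δB : ℝ) : margin (wAB δB) rateABP_recorded = -δB := by
  unfold margin wAB rateABP_recorded; ring

/-- `P̌`: margin `+δ_B`.  [cite: KlainermanSzeftel2021, (9.4.35), TeX l.24456–24461] -/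
theorem marginP_recorded (δB : ℝ) : margin (wP δB) rateABP_recorded = δB := by
  unfold margin wP rateABP_recorded; ring

/-- `B̲`: margin `+δ_B`.  [cite: KlainermanSzeftel2021, (9.4.35), TeX l.24456–24461] -/
theorem marginBb_recorded (δB : ℝ) : margin (wBb δB) rateBb_recorded = δB := by
  unfold margin wBb rateBb_recorded; ring

/-- `A̲` (bulk only): margin `+δ_B`.  [cite: KlainermanSzeftel2021, §9.4.1, TeX l.23912–23915] -/
theorem marginAb_recorded (δB : ℝ) : margin (wAb δB) rateAb_recorded = δB := by
  unfold margin wAb rateAb_recorded; ring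

/-- `A` at Theorem M1's far-field rate: margin `1 + 2δ_extra − δ_B`, positive as soon as `δ_B < 1` and `δ_extra ≥ 0`.
[cite: KlainermanSzeftel2021, Theorem M1 item 2 vs (9.4.35), TeX l.6684–6687] -/
theorem marginA_M1 (δB δextra : ℝ) : margin (wAB δB) (rateA_M1 δextra) = 1 + 2 * δextra - δB := by
  unfold margin wAB rateA_M1; ring

/-- `A`'s margin at Theorem M1's rate is positive for `δ_B < 1`, `δ_extra ≥ 0`.  [cite: KlainermanSzeftel2021, Theorem M1 item 2 vs (9.4.35), TeX l.6684–6687] -/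
theorem marginA_M1_pos {δB δextra : ℝ} (hB : δB < 1) (he : 0 ≤ δextra) : 0 < margin (wAB δB) (rateA_M1 δextra) := by
  rw [marginA_M1]; linarith

/-- `B` at the improved rate `3 + δ'`: margin `2δ' − δ_B = δ_extra − δ_dec − δ_B`.
[cite: KlainermanSzeftel2021, Proposition l.16631–16637 vs (9.4.35)] -/
theorem marginB_improved (δB δextra δdec : ℝ) :
    margin (wAB δB) (rateB_improved δextra δdec) = δextra - δdec - δB := by
  unfold margin wAB rateB_improved deltaPrime; ring

/-- … positive iff `δ_B < δ_extra − δ_dec` — the constraint the count needs; KS (3.4.4) lists `δ_B > 2δ_dec` and Theorem M1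
gives some `δ_extra > δ_dec`, neither of which decides it.  [cite: KlainermanSzeftel2021, (3.4.4) TeX l.6076–6080; Theorem M1 l.6672] -/
theorem marginB_improved_pos_iff (δB δextra δdec : ℝ) :
    0 < margin (wAB δB) (rateB_improved δextra δdec) ↔ δB < δextra - δdec := by
  rw [marginB_improved]; constructor <;> intro h <;> linarith

/-- Within KS alone (`δ_extra` abstract, only `δ_extra > δ_dec`) the two printed constraints do not decide the needed one: a
parameter point satisfying `δ_B > 2δ_dec > 0`, `δ_extra > δ_dec` with the `B`-margin NEGATIVE (`δ_dec = 1/100, δ_B = 3/100,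
δ_extra = 2/100`), and one with it POSITIVE (`δ_extra = 1/10`) — see `marginB_GKS_neg` for the decision once GKS's value of `δ_extra`
is used.  [folklore] -/
theorem marginB_undecided :
    (∃ δB δextra δdec : ℝ, 0 < δdec ∧ 2 * δdec < δB ∧ δdec < δextra ∧ margin (wAB δB) (rateB_improved δextra δdec) < 0) ∧
    (∃ δB δextra δdec : ℝ, 0 < δdec ∧ 2 * δdec < δB ∧ δdec < δextra ∧ 0 < margin (wAB δB) (rateB_improved δextra δdec)) := by
  refine ⟨⟨3/100, 2/100, 1/100, ?_⟩, ⟨3/100, 1/10, 1/100, ?_⟩⟩ <;> rw [marginB_improved] <;> norm_num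

/-- GKS's printed value of `δ_extra`: `(3δ_h − 2δ)/2`, `δ_h` the decay rate fed into GKS (11.1.1) (`δ_h = δ_dec` as printed in
GKS Theorem M1 Step 7; the same expression as `GiorgiKlainermanSzeftel2022.InterpolatedRates.deltaExtra`, restated import-free).
[cite: GiorgiKlainermanSzeftel2022, Theorem M1 ch. 11 Step 7, TeX l.22524; refereed GiorgiKlainermanSzeftel2024 (PAMQ 20 (2024)
no. 7, 2865–3849), HAL hal-05348127 p.532 (PDF p.533)] -/
def deltaExtraGKS (δh δ : ℝ) : ℝ := (3 * δh - 2 * δ) / 2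

/-- With GKS's value the `B`-margin at KS's improved rate is `(3δ_h − 2δ)/2 − δ_dec − δ_B`; for `δ_h = δ_dec`: `δ_dec/2 − δ − δ_B`.
[cite: GiorgiKlainermanSzeftel2022, Theorem M1 ch. 11 Step 7, TeX l.22524; with KlainermanSzeftel2021 Proposition l.16631–16637, (9.4.35)] -/
theorem marginB_GKS (δB δdec δ : ℝ) :
    margin (wAB δB) (rateB_improved (deltaExtraGKS δdec δ) δdec) = δdec / 2 - δ - δB := by
  unfold margin wAB rateB_improved deltaPrime deltaExtraGKS; ring

/-- … and it is NEGATIVE under KS (3.4.4) `δ_B > 2δ_dec` (with `δ_dec, δ ≥ 0`, and any fed rate `δ_h ≤ δ_dec`): explicitly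
`< −(3/2)δ_dec − δ`.  So no printed `ε₀`-size pointwise rate for `B` closes the `r^{3+δ_B}` count.
[cite: KlainermanSzeftel2021, (3.4.4) TeX l.6076–6080; GiorgiKlainermanSzeftel2022, TeX l.22524] -/
theorem marginB_GKS_neg {δB δdec δ δh : ℝ} (hdec : 0 ≤ δdec) (h344 : 2 * δdec < δB) (hδ : 0 ≤ δ) (hh : δh ≤ δdec) :
    margin (wAB δB) (rateB_improved (deltaExtraGKS δh δ) δdec) < -(3 / 2) * δdec - δ ∧
      margin (wAB δB) (rateB_improved (deltaExtraGKS δh δ) δdec) < 0 := by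
  have hm : margin (wAB δB) (rateB_improved (deltaExtraGKS δh δ) δdec) = 3 / 2 * δh - δ - δdec - δB := by
    unfold margin wAB rateB_improved deltaPrime deltaExtraGKS; ring
  rw [hm]; constructor <;> linarith

/-- For comparison (NOT printed for the exterior region; it is the rate KS has for `B` on `Σ_*`, l.12791, and for `A` by Thm M1):
rate `7/2 + δ_extra` for `B` has margin `1 + 2δ_extra − δ_B`, the same as `marginA_M1`.  [cite: KlainermanSzeftel2021, TeX l.12791, l.6684–6687] -/
theorem marginB_rateM1 (δB δextra : ℝ) : margin (wAB δB) (rateA_M1 δextra) = 1 + 2 * δextra - δB := by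
  unfold margin wAB rateA_M1; ring

/-- For comparison (NOT a printed statement): the peeling rate `a_B = 4` has margin `2 − δ_B`.  [folklore] -/
theorem marginB_rate4 (δB : ℝ) : margin (wAB δB) 4 = 2 - δB := by unfold margin wAB; ring

/-- `Σ_*`-term power: on `Σ_*` (`r ≍ r_*`, area `≍ r_*² du`) the weight-`r^{w}` term at rate `a` carries `r_*^{w+2−2a}`.  For
`B` in `ℜ*` (`w = 4+δ_B`): `+δ_B` at the recorded rate (grows with `r_* = δ_*ε₀^{-1}u_*^{1+δ_dec}`), `−1` at the boundedness rate
`7/2 + δ_B/2` (decays like `r_*^{-1} ≍ ε₀`).  [cite: KlainermanSzeftel2021, §9.4.1 l.23886–23889; l.5813; r_* condition l.6103–6106] -/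
theorem starPowerB_recorded (δB : ℝ) : wABstar δB + 2 - 2 * rateABP_recorded = δB := by
  unfold wABstar rateABP_recorded; ring

/-- … and `−1` at the boundedness rate `7/2 + δ_B/2` of `ᵉˣᵗ𝔅_k`.  [cite: KlainermanSzeftel2021, boundedness norms in Mext l.5813 vs §9.4.1 l.23886–23889] -/
theorem starPowerB_bounded (δB : ℝ) : wABstar δB + 2 - 2 * rateAB_bounded δB = -1 := by
  unfold wABstar rateAB_bounded; ring

/-! ## §3 The radial integrals: bounded iff the margin is positive -/

/-- Positive margin `m`: `∫_{r₀}^{R} x^{-1-m} dx = (r₀^{-m} − R^{-m})/m ≤ r₀^{-m}/m`, uniformly in `R ≥ r₀ > 0`.  [folklore] -/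
theorem radial_bounded_of_margin_pos {m r₀ R : ℝ} (hm : 0 < m) (hr₀ : 0 < r₀) (hR : r₀ ≤ R) :
    ∫ x in r₀..R, x ^ (-1 - m) ≤ r₀ ^ (-m) / m := by
  have hR0 : 0 < R := hr₀.trans_le hR
  have h0 : (0:ℝ) ∉ uIcc r₀ R := by
    rw [uIcc_of_le hR]; intro h; exact absurd h.1 (not_le.mpr hr₀)
  rw [integral_rpow (Or.inr ⟨by linarith, h0⟩)]
  have h1 : -1 - m + 1 = -m := by ring
  rw [h1]
  have hRm : 0 < R ^ (-m) := rpow_pos_of_pos hR0 _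
  have : (R ^ (-m) - r₀ ^ (-m)) / -m = (r₀ ^ (-m) - R ^ (-m)) / m := by
    rw [div_neg, ← neg_div, neg_sub]
  rw [this]
  exact div_le_div_of_nonneg_right (by linarith) hm.le

/-- Nonpositive margin, the case that occurs (`m = −δ_B < 0`): `∫_{r₀}^{R} x^{-1+δ} dx = (R^{δ} − r₀^{δ})/δ → ∞` as `R → ∞`.
[folklore] -/
theorem radial_unbounded_of_margin_neg {δ r₀ : ℝ} (hδ : 0 < δ) (hr₀ : 0 < r₀) :
    Tendsto (fun R : ℝ => ∫ x in r₀..R, x ^ (-1 + δ)) atTop atTop := by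
  have key : ∀ R : ℝ, r₀ ≤ R → ∫ x in r₀..R, x ^ (-1 + δ) = (R ^ δ - r₀ ^ δ) / δ := by
    intro R hR
    have h0 : (0:ℝ) ∉ uIcc r₀ R := by
      rw [uIcc_of_le hR]; intro h; exact absurd h.1 (not_le.mpr hr₀)
    rw [integral_rpow (Or.inl (by linarith))]
    have h1 : -1 + δ + 1 = δ := by ring
    rw [h1]
  have hlim : Tendsto (fun R : ℝ => (R ^ δ - r₀ ^ δ) / δ) atTop atTop := by
    apply Tendsto.atTop_div_const hδ
    apply tendsto_atTop_add_const_right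
    exact tendsto_rpow_atTop hδ
  refine (tendsto_congr' ?_).mpr hlim
  filter_upwards [eventually_ge_atTop r₀] with R hR using key R hR

/-- APPLIED, recorded rate: the `(A,B)`-integrand of the cone flux `∫_{u=u₁}|Ř|²_{w,k}` is `r^{-1+δ_B}` and its radial integral is
unbounded in the outer radius.  [cite: KlainermanSzeftel2021, (9.4.35) with proof of Lemma 9.4.13, TeX l.24456–24461, l.24364–24369] -/
theorem coneFluxAB_recorded_unbounded {δB r₀ : ℝ} (hδB : 0 < δB) (hr₀ : 0 < r₀) :
    wAB δB + 2 - 2 * rateABP_recorded = -1 + δB ∧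
      Tendsto (fun R : ℝ => ∫ x in r₀..R, x ^ (wAB δB + 2 - 2 * rateABP_recorded)) atTop atTop := by
  have h : wAB δB + 2 - 2 * rateABP_recorded = -1 + δB := by unfold wAB rateABP_recorded; ring
  refine ⟨h, ?_⟩
  simp_rw [h]
  exact radial_unbounded_of_margin_neg hδB hr₀

/-- APPLIED, improved rate for `B` under `δ_B < δ_extra − δ_dec`: the radial integral is bounded by `r₀^{-m}/m`,
`m = δ_extra − δ_dec − δ_B`, uniformly in the outer radius.  [cite: KlainermanSzeftel2021, Proposition l.16631–16637 with (9.4.35)] -/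
theorem coneFluxB_improved_bounded {δB δextra δdec r₀ R : ℝ} (hc : δB < δextra - δdec) (hr₀ : 0 < r₀) (hR : r₀ ≤ R) :
    ∫ x in r₀..R, x ^ (wAB δB + 2 - 2 * rateB_improved δextra δdec) ≤
      r₀ ^ (-(δextra - δdec - δB)) / (δextra - δdec - δB) := by
  have hm : 0 < δextra - δdec - δB := by linarith
  have h : wAB δB + 2 - 2 * rateB_improved δextra δdec = -1 - (δextra - δdec - δB) := by
    unfold wAB rateB_improved deltaPrime; ring
  rw [h]
  exact radial_bounded_of_margin_pos hm hr₀ hR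

/-- APPLIED, `P̌` / `B̲` / `A̲` at the recorded rates: bounded by `r₀^{-δ_B}/δ_B`.  [cite: KlainermanSzeftel2021, (9.4.35), §9.4.1] -/
theorem coneFluxPBbAb_recorded_bounded {δB r₀ R : ℝ} (hδB : 0 < δB) (hr₀ : 0 < r₀) (hR : r₀ ≤ R) :
    (∫ x in r₀..R, x ^ (wP δB + 2 - 2 * rateABP_recorded) ≤ r₀ ^ (-δB) / δB) ∧
    (∫ x in r₀..R, x ^ (wBb δB + 2 - 2 * rateBb_recorded) ≤ r₀ ^ (-δB) / δB) ∧
    (∫ x in r₀..R, x ^ (wAb δB + 2 - 2 * rateAb_recorded) ≤ r₀ ^ (-δB) / δB) := by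
  have h1 : wP δB + 2 - 2 * rateABP_recorded = -1 - δB := by unfold wP rateABP_recorded; ring
  have h2 : wBb δB + 2 - 2 * rateBb_recorded = -1 - δB := by unfold wBb rateBb_recorded; ring
  have h3 : wAb δB + 2 - 2 * rateAb_recorded = -1 - δB := by unfold wAb rateAb_recorded; ring
  rw [h1, h2, h3]
  exact ⟨radial_bounded_of_margin_pos hδB hr₀ hR, radial_bounded_of_margin_pos hδB hr₀ hR,
    radial_bounded_of_margin_pos hδB hr₀ hR⟩

/-- The size of the supercritical factor at the outer radius of `𝓜`: `R = δ_* ε₀^{-1} u_*^{1+δ_dec}` gives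
`R^{δ_B} = δ_*^{δ_B} · ε₀^{-δ_B} · u_*^{(1+δ_dec)δ_B}` — an inverse power of `ε₀`.  [cite: KlainermanSzeftel2021, r_* condition eq:behaviorofronS-star, TeX l.6103–6106] -/
theorem rstar_pow {δstar ε₀ ustar δdec δB : ℝ} (hδ : 0 < δstar) (hε : 0 < ε₀) (hu : 0 < ustar) :
    (δstar * ε₀⁻¹ * ustar ^ (1 + δdec)) ^ δB = δstar ^ δB * ε₀ ^ (-δB) * ustar ^ ((1 + δdec) * δB) := by
  rw [mul_rpow (by positivity) (by positivity), mul_rpow hδ.le (by positivity), ← rpow_mul hu.le,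
    rpow_neg hε.le, inv_rpow hε.le]

end Literature.Geometry.Lorentzian.KlainermanSzeftel2021.SupToFluxExponents

end
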